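import Summits.CriticalPhenomena.CardyFormulaZ2.Theorems.CardySelfDualSegmentUniformMarginalityRussoBoundLargeMesh
import Summits.CriticalPhenomena.CardyFormulaZ2.Theorems.CardySelfDualSegmentUniformMarginalityStubPextContinuous

/-!
# Transport glue of line `Sketch` (crux `UniformMarginality`, stmt-CriticalPhenomena-5472)

Skeleton v3 of the lead's line (`Cruxes/UniformMarginality/Lines/Sketch.lean`) splits the transport stub
(B₂) `RectilinearTransport` of `Theorems/CardySelfDualSegmentUniformMarginalityDefs3.lean` into a research
kernel (B₂a) — LOCAL UNIFORM RECTILINEAR SANDWICHES: every conformal rectangle `R` is squeezed, near every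
`t₀ ∈ [0,1]`, between two rectilinear conformal rectangles `R', R''` whose crude `M_t`-crossing
probabilities are nested and `ε`-close for all meshes `δ < δ₀` and all `|t − t₀| < η₀` — and the glue
proved here, written (like the skeleton) in the vocabulary of the Defs file only: the tame class
`IsRectilinear R` and the per-rectangle modulus `IntegratedBoundAt R` of Defs3 are spelled out, so the
statements below are definitionally `(B₂a) → (∀ R, IsRectilinear R → IntegratedBoundAt R) → IntegratedBound`:

* `integratedBoundAt_of_le_mesh` — the mesh-uniform modulus of continuity is FREE for meshes bounded
  below (`δ ≥ δ₁ > 0`): mean value theorem with the landed large-mesh Russo bound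
  `russoBound_largeMesh`, differentiability from `stub_russoIdentity`, continuity from
  `stub_pextContinuous`;
* `stub_transportOfUniformSandwich` — (B₂a) and (B₁) give `IntegratedBound`: for `δ < δ₀`,
  `P_t(R) − P_{t₀}(R) ≤ (P_t(R'') − P_{t₀}(R'')) + (P_{t₀}(R'') − P_{t₀}(R'))` and symmetrically from
  below, using `IntegratedBoundAt R'`, `IntegratedBoundAt R''` and the tightness at `t₀`; for
  `δ ≥ δ₀` the large-mesh modulus.
-/

noncomputable section

namespace Summit.CriticalPhenomena.CardyFormulaZ2.Cruxes.UniformMarginality.HeatFlow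

open MeasureTheory Literature.Probability.Percolation Literature.Probability.LatticeModels
  Literature.Probability.RandomPlanarGeometry

/-- **Large-mesh modulus of continuity.** For meshes bounded below, `δ ≥ δ₁ > 0`, the map
`t ↦ P_t(R,δ)` has a modulus of continuity on `[0,1]` uniform in `δ`: `|∂_t P_t(R,δ)| ≤ C(R,δ₁)` on
`(0,1)` (`russoBound_largeMesh`), so `|P_t − P_{t₀}| ≤ C |t − t₀|` by the mean value theorem
(`stub_russoIdentity` for differentiability, `stub_pextContinuous` for continuity at the endpoints). -/
theorem integratedBoundAt_of_le_mesh (R : ConformalRectangle) {δ₁ : ℝ} (hδ₁ : 0 < δ₁)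
    {ε : ℝ} (hε : 0 < ε) :
    ∃ η > 0, ∀ δ : ℝ, δ₁ ≤ δ → ∀ t ∈ Set.Icc (0 : ℝ) 1, ∀ t₀ ∈ Set.Icc (0 : ℝ) 1,
      |t - t₀| < η → |Pext R δ t - Pext R δ t₀| < ε := by
  obtain ⟨C, hC⟩ := russoBound_largeMesh R δ₁ hδ₁
  set C' : ℝ := max C 1 with hC'
  have hC'pos : 0 < C' := lt_of_lt_of_le one_pos (le_max_right C 1)
  have hCC' : C ≤ C' := le_max_left C 1
  refine ⟨ε / (2 * C'), by positivity, ?_⟩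
  intro δ hδ t ht t₀ ht₀ htt₀
  have hδpos : 0 < δ := lt_of_lt_of_le hδ₁ hδ
  obtain ⟨K, -, hderiv⟩ := stub_russoIdentity R δ hδpos
  have hcont : Continuous (Pext R δ) := stub_pextContinuous R δ hδpos
  have hdiff : ∀ c ∈ Set.Ioo (0 : ℝ) 1, DifferentiableAt ℝ (Pext R δ) c :=
    fun c hc => (hderiv c hc).differentiableAt
  -- Lipschitz estimate between two points `a < b` of `[0,1]`
  have key : ∀ a b : ℝ, a ∈ Set.Icc (0 : ℝ) 1 → b ∈ Set.Icc (0 : ℝ) 1 → a < b →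
      |Pext R δ b - Pext R δ a| ≤ C' * (b - a) := by
    intro a b ha hb hab
    have hco : ContinuousOn (Pext R δ) (Set.Icc a b) := hcont.continuousOn
    have hdo : DifferentiableOn ℝ (Pext R δ) (Set.Ioo a b) := by
      intro c hc
      exact (hdiff c ⟨lt_of_le_of_lt ha.1 hc.1, lt_of_lt_of_le hc.2 hb.2⟩).differentiableWithinAt
    obtain ⟨c, hc, hcslope⟩ := exists_deriv_eq_slope (Pext R δ) hab hco hdo
    have hc01 : c ∈ Set.Ioo (0 : ℝ) 1 := ⟨lt_of_le_of_lt ha.1 hc.1, lt_of_lt_of_le hc.2 hb.2⟩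
    have hbound : |deriv (Pext R δ) c| ≤ C' := (hC δ hδ c hc01).trans hCC'
    have hba : 0 < b - a := sub_pos.2 hab
    have heq : Pext R δ b - Pext R δ a = deriv (Pext R δ) c * (b - a) := by
      rw [hcslope, div_mul_cancel₀ _ hba.ne']
    rw [heq, abs_mul, abs_of_pos hba]
    exact mul_le_mul_of_nonneg_right hbound hba.le
  rcases lt_trichotomy t t₀ with hlt | heq | hgt
  · have h := key t t₀ ht ht₀ hlt
    have hpos : 0 < t₀ - t := sub_pos.2 hlt
    have habs : |t - t₀| = t₀ - t := by rw [abs_sub_comm]; exact abs_of_pos hpos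
    calc |Pext R δ t - Pext R δ t₀| = |Pext R δ t₀ - Pext R δ t| := abs_sub_comm _ _
      _ ≤ C' * (t₀ - t) := h
      _ < C' * (ε / (2 * C')) := by rw [← habs]; exact mul_lt_mul_of_pos_left htt₀ hC'pos
      _ = ε / 2 := by field_simp
      _ < ε := by linarith
  · subst heq; simpa using hε
  · have h := key t₀ t ht₀ ht hgt
    have hpos : 0 < t - t₀ := sub_pos.2 hgt
    have habs : |t - t₀| = t - t₀ := abs_of_pos hpos
    calc |Pext R δ t - Pext R δ t₀| ≤ C' * (t - t₀) := h
      _ < C' * (ε / (2 * C')) := by rw [← habs]; exact mul_lt_mul_of_pos_left htt₀ hC'pos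
      _ = ε / 2 := by field_simp
      _ < ε := by linarith

/-- STUB (B₂b) of skeleton v3 — **transport glue**: local uniform rectilinear sandwiches (B₂a) carry the
mesh-uniform modulus of continuity in `t` from rectilinear conformal rectangles (B₁) to every conformal
rectangle (`IntegratedBound`, which is the crux by `uniformMarginality_of_integratedBound`). Given `R`, `t₀`, `ε`: take the sandwich `R' ≤ R ≤ R''` with tightness `ε/3` on
`δ < δ₀`, `|t − t₀| < η₀`; the rectilinear moduli `η'`, `η''` of `R'`, `R''` at `t₀` for `ε/3`; and
the large-mesh modulus `η₁` for `δ ≥ δ₀`; then `η = min (min η₀ η₁) (min η' η'')` serves. -/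
theorem stub_transportOfUniformSandwich :
    (∀ (R : ConformalRectangle) (t₀ : ℝ), t₀ ∈ Set.Icc (0 : ℝ) 1 → ∀ ε : ℝ, 0 < ε →
      ∃ R' R'' : ConformalRectangle,
        (∃ S : Finset (ℂ × ℂ), (∀ p ∈ S, p.1.re = p.2.re ∨ p.1.im = p.2.im) ∧
          frontier R'.carrier ⊆ ⋃ p ∈ S, segment ℝ p.1 p.2) ∧
        (∃ S : Finset (ℂ × ℂ), (∀ p ∈ S, p.1.re = p.2.re ∨ p.1.im = p.2.im) ∧
          frontier R''.carrier ⊆ ⋃ p ∈ S, segment ℝ p.1 p.2) ∧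
        ∃ δ₀ > 0, ∃ η₀ > 0, ∀ δ : ℝ, 0 < δ → δ < δ₀ → ∀ t ∈ Set.Icc (0 : ℝ) 1, |t - t₀| < η₀ →
          Pext R' δ t ≤ Pext R δ t ∧ Pext R δ t ≤ Pext R'' δ t ∧ Pext R'' δ t - Pext R' δ t ≤ ε) →
    (∀ R : ConformalRectangle,
      (∃ S : Finset (ℂ × ℂ), (∀ p ∈ S, p.1.re = p.2.re ∨ p.1.im = p.2.im) ∧
        frontier R.carrier ⊆ ⋃ p ∈ S, segment ℝ p.1 p.2) →
      ∀ t₀ : ℝ, t₀ ∈ Set.Icc (0 : ℝ) 1 → ∀ ε > 0, ∃ η > 0,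
        ∀ δ : ℝ, 0 < δ → ∀ t ∈ Set.Icc (0 : ℝ) 1, |t - t₀| < η → |Pext R δ t - Pext R δ t₀| < ε) →
    IntegratedBound := by
  intro hS hTame R t₀ ht₀ ε hε
  have hε3 : 0 < ε / 3 := by positivity
  obtain ⟨R', R'', hR', hR'', δ₀, hδ₀, η₀, hη₀, hsand⟩ := hS R t₀ ht₀ (ε / 3) hε3
  obtain ⟨η', hη', h'⟩ := hTame R' hR' t₀ ht₀ (ε / 3) hε3
  obtain ⟨η'', hη'', h''⟩ := hTame R'' hR'' t₀ ht₀ (ε / 3) hε3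
  obtain ⟨η₁, hη₁, h₁⟩ := integratedBoundAt_of_le_mesh R hδ₀ hε
  refine ⟨min (min η₀ η₁) (min η' η''), lt_min (lt_min hη₀ hη₁) (lt_min hη' hη''), ?_⟩
  intro δ hδ t ht htt₀
  have ht₀' : |t - t₀| < η₀ := lt_of_lt_of_le htt₀ ((min_le_left _ _).trans (min_le_left _ _))
  have ht₁' : |t - t₀| < η₁ := lt_of_lt_of_le htt₀ ((min_le_left _ _).trans (min_le_right _ _))
  have ht' : |t - t₀| < η' := lt_of_lt_of_le htt₀ ((min_le_right _ _).trans (min_le_left _ _))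
  have ht'' : |t - t₀| < η'' := lt_of_lt_of_le htt₀ ((min_le_right _ _).trans (min_le_right _ _))
  by_cases hsmall : δ < δ₀
  · -- small mesh: squeeze
    obtain ⟨hlo_t, hhi_t, -⟩ := hsand δ hδ hsmall t ht ht₀'
    have h00 : |t₀ - t₀| < η₀ := by simpa using hη₀
    obtain ⟨hlo_0, hhi_0, htight_0⟩ := hsand δ hδ hsmall t₀ ht₀ h00
    have hA := h' δ hδ t ht ht'       -- |P_t(R') − P_{t₀}(R')| < ε/3
    have hB := h'' δ hδ t ht ht''     -- |P_t(R'') − P_{t₀}(R'')| < ε/3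
    rw [abs_lt] at hA hB ⊢
    constructor
    · -- lower: P_t(R) − P_{t₀}(R) ≥ (P_t(R') − P_{t₀}(R')) − (P_{t₀}(R'') − P_{t₀}(R'))
      linarith [hA.1]
    · -- upper: P_t(R) − P_{t₀}(R) ≤ (P_t(R'') − P_{t₀}(R'')) + (P_{t₀}(R'') − P_{t₀}(R'))
      linarith [hB.2]
  · -- large mesh: free
    exact h₁ δ (le_of_not_gt hsmall) t ht t₀ ht₀ ht₁'

end Summit.CriticalPhenomena.CardyFormulaZ2.Cruxes.UniformMarginality.HeatFlow

end
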